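import Summits.Ventures.LatticeQCDFlow.Scoring.KickDriftSymmetry
import Summits.Ventures.LatticeQCDFlow.TrivializingMaps.GaugeCovariance
import Summits.Ventures.LatticeQCDFlow.TrivializingMaps.DefectLogWeight
import HarnessLib

/-!
# The HMC momentum draw — i.i.d. standard Gaussian coefficients in an orthonormal basis of `𝔰𝔲(n)` on every link — is invariant under the gauge, translation and time-reflection transports of the momenta

HONEST FRAMING: exact (Metropolis-corrected) sampling algorithms for lattice gauge theory;
figures of merit are autocorrelation/cost numbers at stated couplings and volumes; no
continuum-physics claim.

Venture `LatticeQCDFlow` (cell pub-lqcd), sub-topic `Scoring`; FANOUT row 16 (`su2-base`, arm E2 = HMC/OMF4).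
Sequel of `Scoring/KickDriftSymmetry` (the deterministic half: every kick–drift word is equivariant under the
lifted gauge transformation `gaugeReg`, translation `transReg` and time reflection `reflReg U`, and `K`, `H`,
`ΔH` are invariant).  This file is the STOCHASTIC half for the momentum refresh: the law of the engine's
momentum draw is invariant under the same three transports.  NEW WORK of the cell over Mathlib's standard
Gaussian (`ProbabilityTheory.stdGaussian`, `stdGaussian_map`: invariance under linear isometric equivalences;
`map_pi_eq_stdGaussian`) and the tree's `𝔰𝔲(n)` basis calculus (`Luscher2010.SuBasis`: `tr TᵃTᵇ = −½δ`;
`TrivializingMaps.suBasis_coord_sum_smul`, `sum_coord_smul_eq`).  Nothing is cited as a fact; no number.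

## What is here (every `d`, `L ≥ 1`, `n`, every orthonormal basis `B : SuBasis n`)

* §1 `momOf B c = (Σ_a c(e,a) Tᵃ)_e` (the engine's `random_algebra` assembly) and `coordOf B P = ((P_e)ᵃ)`,
  inverse to each other (`coordOf_momOf`, `momOf_coordOf`), linear; **Parseval** `sum_coord_sq`
  (`Σ_a (Xᵃ)² = 2 Re tr(XᴴX)` on `𝔰𝔲(n)`) and `sum_coordOf_sq`: `Σ_q (coordOf P q)² = 2·K(P)` with the kinetic
  energy `K` of `KickDriftSymmetry` — so the i.i.d. `N(0,1)` coefficient law has density `∝ e^{−K(P)}`.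
* §2 for a LINEAR transport `T` of momentum fields with `K(TP) = K(P)`: its coordinate form `coordMap B T`
  preserves `Σc²` (`sum_sq_coordMap`) and is a linear isometric equivalence of `ℝ^{E×ι}` (`coordIsometry`).
* §3 **`pi_gaussian_map_coordMap`**: the product standard Gaussian on `ℝ^{E×ι}` is invariant under
  `coordMap B T`; `measurePreserving_coordMap`; **`integral_comp_transport`**: `E[F(T P)] = E[F(P)]` for EVERY
  function `F` of the momentum field (no measurability hypothesis), and `measure_transport_momOf_mem`:
  `ℙ{T P ∈ A} = ℙ{P ∈ A}` for every set `A`.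
* §4 the three transports as linear maps (`gaugeRegₗ`, `transRegₗ`, `reflRegₗ`; kinetic invariance from
  `KickDriftSymmetry`) and the instances **`integral_comp_gaugeReg`**, **`integral_comp_transReg`**,
  **`integral_comp_reflReg`** (relative to ANY link field `W`), `measure_reflReg_momOf_mem`.

With `KickDriftSymmetry` this supplies every ingredient of "the HMC kernel of arm E2 commutes with `Θ'`, with
gauge transformations and with translations": proposal map equivariant, `ΔH` invariant, momentum law
invariant.  NOT here: the kernel-level composition itself (Metropolis step as a Markov kernel and the
`conjKernel` identity consumed by `SymmetricSamplerOddObservables`); independence of the law from the basis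
`B` (true — it is the standard Gaussian of the trace form — but not needed); any number.
-/

noncomputable section

open Matrix MeasureTheory ProbabilityTheory WithLp Literature.MathematicalPhysics.QuantumFieldTheory
open Literature.MathematicalPhysics.QuantumFieldTheory.Luscher2010 (SuBasis)
open Summit.Ventures.LatticeQCDFlow.TrivializingMaps (sum_coord_smul_eq suBasis_coord_sum_smul)

namespace Summit.Ventures.LatticeQCDFlow.Scoring

variable {d L n : ℕ} (B : SuBasis n)

/-! ## §1 Momenta and their coordinates in an orthonormal basis of `𝔰𝔲(n)` -/

section Coordinates

/-- The momentum field with coefficients `c`: `P(e) = Σ_a c(e,a) Tᵃ` (the engine's `random_algebra` assembles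
exactly this from i.i.d. normal `c`). -/
def momOf (c : Edge d L × B.ι → ℝ) : Edge d L → suAlgebra n :=
  fun e => ⟨∑ a, ((c (e, a) : ℝ) : ℂ) • B.T a,
    (mem_suAlgebra_iff _).2
      ⟨by
        rw [Matrix.conjTranspose_sum, ← Finset.sum_neg_distrib]
        refine Finset.sum_congr rfl fun a _ => ?_
        rw [Matrix.conjTranspose_smul, ((mem_suAlgebra_iff _).1 (B.mem a)).1, Complex.star_def,
          Complex.conj_ofReal, smul_neg],
       by
        rw [Matrix.trace_sum]
        exact Finset.sum_eq_zero fun a _ => by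
          rw [Matrix.trace_smul, ((mem_suAlgebra_iff _).1 (B.mem a)).2, smul_zero]⟩⟩

/-- The coordinates `P ↦ (P(e))ᵃ = −2 Re tr(Tᵃ P(e))` of a momentum field. -/
def coordOf (P : Edge d L → suAlgebra n) : Edge d L × B.ι → ℝ :=
  fun q => B.coord q.2 ((P q.1 : suAlgebra n) : Matrix (Fin n) (Fin n) ℂ)

/-- `momOf` read as matrices. -/
@[simp] theorem coe_momOf (c : Edge d L × B.ι → ℝ) (e : Edge d L) :
    ((momOf B c e : suAlgebra n) : Matrix (Fin n) (Fin n) ℂ) = ∑ a, ((c (e, a) : ℝ) : ℂ) • B.T a := rfl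

/-- `coordOf (momOf c) = c` (orthonormality `tr TᵃTᵇ = −½δ`). -/
@[simp] theorem coordOf_momOf (c : Edge d L × B.ι → ℝ) : coordOf B (momOf B c) = c := by
  funext q
  obtain ⟨e, a⟩ := q
  simp only [coordOf, coe_momOf]
  exact suBasis_coord_sum_smul B (fun b => c (e, b)) a

/-- `momOf (coordOf P) = P` (completeness). -/
@[simp] theorem momOf_coordOf (P : Edge d L → suAlgebra n) : momOf B (coordOf B P) = P := by
  funext e
  apply Subtype.ext
  simp only [coe_momOf, coordOf]
  exact sum_coord_smul_eq B (P e).2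

/-- The coordinate map is additive … -/
theorem coordOf_add (P Q : Edge d L → suAlgebra n) : coordOf B (P + Q) = coordOf B P + coordOf B Q := by
  funext q
  simp only [coordOf, Pi.add_apply, Submodule.coe_add, SuBasis.coord, Matrix.mul_add, Matrix.trace_add,
    Complex.add_re]
  ring

/-- … and homogeneous. -/
theorem coordOf_smul (r : ℝ) (P : Edge d L → suAlgebra n) : coordOf B (r • P) = r • coordOf B P := by
  funext q
  simp only [coordOf, Pi.smul_apply, Submodule.coe_smul, SuBasis.coord, Matrix.mul_smul, Matrix.trace_smul,
    Complex.real_smul, Complex.re_ofReal_mul, smul_eq_mul]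
  ring

/-- **Parseval on one link**: `Σ_a (Xᵃ)² = 2 Re tr(Xᴴ X)` for `X ∈ 𝔰𝔲(n)`. -/
theorem sum_coord_sq {X : Matrix (Fin n) (Fin n) ℂ} (hX : X ∈ suAlgebra n) :
    ∑ a, B.coord a X ^ 2 = 2 * (Xᴴ * X).trace.re := by
  have hskew : Xᴴ = -X := ((mem_suAlgebra_iff _).1 hX).1
  set x : B.ι → ℝ := fun a => B.coord a X with hx
  have hXe : X = ∑ a, ((x a : ℝ) : ℂ) • B.T a := (sum_coord_smul_eq B hX).symm
  have htr : (X * X).trace = -(1 / 2 : ℂ) * ∑ a, ((x a : ℝ) : ℂ) ^ 2 := by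
    conv_lhs => rw [hXe]
    rw [Finset.sum_mul_sum, Matrix.trace_sum]
    simp_rw [Matrix.trace_sum, Matrix.smul_mul, Matrix.mul_smul, Matrix.trace_smul, smul_eq_mul, B.orth,
      mul_ite, mul_zero]
    simp_rw [Finset.sum_ite_eq, Finset.mem_univ, if_true, Finset.mul_sum]
    refine Finset.sum_congr rfl fun a _ => ?_
    ring
  rw [hskew, Matrix.neg_mul, Matrix.trace_neg, htr]
  simp only [Complex.neg_re, Complex.mul_re, Complex.re_sum, Complex.im_sum]
  have h1 : ∀ a, (((x a : ℝ) : ℂ) ^ 2).re = x a ^ 2 := fun a => by rw [← Complex.ofReal_pow, Complex.ofReal_re]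
  have h2 : ∀ a, (((x a : ℝ) : ℂ) ^ 2).im = 0 := fun a => by rw [← Complex.ofReal_pow, Complex.ofReal_im]
  simp only [h1, h2, Finset.sum_const_zero, mul_zero, sub_zero]
  show ∑ a, x a ^ 2 = _
  simp only [Complex.div_ofNat_re, Complex.one_re]
  ring

/-- **Parseval for momentum fields**: `Σ_q (coordOf P q)² = 2·K(P)` with `K` the kinetic energy of
`KickDriftSymmetry` (`K(P) = Σ_e Re tr(P_eᴴ P_e) = ½ Σ (pᵃ_e)²`, the engine's `0.5*sum(p**2)`). -/
theorem sum_coordOf_sq [NeZero L] (P : Edge d L → suAlgebra n) :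
    ∑ q, coordOf B P q ^ 2 = 2 * kinetic P := by
  rw [Fintype.sum_prod_type]
  simp only [coordOf, kinetic, Finset.mul_sum]
  exact Finset.sum_congr rfl fun e _ => sum_coord_sq B (P e).2

end Coordinates

/-! ## §2 A linear, kinetic-energy-preserving transport of the momenta acts on coordinates by a linear isometry -/

section Isometry

variable [NeZero L]

/-- The coordinate form `c ↦ coordOf (T (momOf c))` of a transport `T` of momentum fields, as a linear map. -/
def coordMap (T : (Edge d L → suAlgebra n) →ₗ[ℝ] (Edge d L → suAlgebra n)) :
    (Edge d L × B.ι → ℝ) →ₗ[ℝ] (Edge d L × B.ι → ℝ) where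
  toFun c := coordOf B (T (momOf B c))
  map_add' c c' := by
    have h : momOf B (c + c') = momOf B c + momOf B c' := by
      rw [← momOf_coordOf B (momOf B c + momOf B c'), coordOf_add, coordOf_momOf, coordOf_momOf]
    rw [h, map_add, coordOf_add]
  map_smul' r c := by
    have h : momOf B (r • c) = r • momOf B c := by
      rw [← momOf_coordOf B (r • momOf B c), coordOf_smul, coordOf_momOf]
    rw [h, map_smul, coordOf_smul, RingHom.id_apply]

omit [NeZero L] in
/-- `coordMap` evaluated. -/
@[simp] theorem coordMap_apply (T : (Edge d L → suAlgebra n) →ₗ[ℝ] (Edge d L → suAlgebra n))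
    (c : Edge d L × B.ι → ℝ) : coordMap B T c = coordOf B (T (momOf B c)) := rfl

omit [NeZero L] in
/-- The transport is conjugate to its coordinate form: `T ∘ momOf = momOf ∘ coordMap T`. -/
theorem apply_momOf (T : (Edge d L → suAlgebra n) →ₗ[ℝ] (Edge d L → suAlgebra n)) (c : Edge d L × B.ι → ℝ) :
    T (momOf B c) = momOf B (coordMap B T c) := by
  rw [coordMap_apply, momOf_coordOf]

/-- A kinetic-energy-preserving transport preserves `Σ c²` in coordinates. -/
theorem sum_sq_coordMap {T : (Edge d L → suAlgebra n) →ₗ[ℝ] (Edge d L → suAlgebra n)}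
    (hT : ∀ P, kinetic (T P) = kinetic P) (c : Edge d L × B.ι → ℝ) :
    ∑ q, coordMap B T c q ^ 2 = ∑ q, c q ^ 2 := by
  rw [coordMap_apply, sum_coordOf_sq, hT, ← sum_coordOf_sq B, coordOf_momOf]

/-- **The coordinate form of a linear kinetic-energy-preserving transport is a linear isometry of the
Euclidean space `ℝ^{E × ι}`** (hence an isometric equivalence: equal finite dimension). -/
def coordIsometry (T : (Edge d L → suAlgebra n) →ₗ[ℝ] (Edge d L → suAlgebra n)) (hT : ∀ P, kinetic (T P) = kinetic P) :
    EuclideanSpace ℝ (Edge d L × B.ι) ≃ₗᵢ[ℝ] EuclideanSpace ℝ (Edge d L × B.ι) :=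
  LinearIsometry.toLinearIsometryEquiv
    { toLinearMap := (WithLp.linearEquiv 2 ℝ (Edge d L × B.ι → ℝ)).symm.toLinearMap ∘ₗ coordMap B T ∘ₗ
        (WithLp.linearEquiv 2 ℝ (Edge d L × B.ι → ℝ)).toLinearMap
      norm_map' := fun x => by
        rw [← sq_eq_sq₀ (norm_nonneg _) (norm_nonneg _), EuclideanSpace.real_norm_sq_eq,
          EuclideanSpace.real_norm_sq_eq]
        exact sum_sq_coordMap B hT (ofLp x) }
    rfl

/-- `coordIsometry` acts by `coordMap` in coordinates. -/
theorem coordIsometry_apply (T : (Edge d L → suAlgebra n) →ₗ[ℝ] (Edge d L → suAlgebra n))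
    (hT : ∀ P, kinetic (T P) = kinetic P) (x : EuclideanSpace ℝ (Edge d L × B.ι)) :
    coordIsometry B T hT x = toLp 2 (coordMap B T (ofLp x)) := rfl

end Isometry

/-! ## §3 The Gaussian coefficient law is invariant under every linear kinetic-energy-preserving transport -/

section Law

variable [NeZero L]

/-- **The i.i.d. standard Gaussian law of the coefficients `c(e,a)`** — the engine's momentum draw
(`momenta()` / `random_algebra`: `P = Σ_a c(e,a) Tᵃ`, density `∝ e^{−K(P)}`, `K = ½Σc²`) — **is invariant
under the coordinate form of every linear kinetic-energy-preserving transport of the momenta** (it is the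
standard Gaussian of `ℝ^{E×ι}`, invariant under linear isometries: Mathlib's `stdGaussian_map`). -/
theorem pi_gaussian_map_coordMap (T : (Edge d L → suAlgebra n) →ₗ[ℝ] (Edge d L → suAlgebra n))
    (hT : ∀ P, kinetic (T P) = kinetic P) :
    (Measure.pi fun _ : Edge d L × B.ι => gaussianReal 0 1).map (coordMap B T) =
      Measure.pi fun _ : Edge d L × B.ι => gaussianReal 0 1 := by
  set γ : Measure (Edge d L × B.ι → ℝ) := Measure.pi fun _ : Edge d L × B.ι => gaussianReal 0 1 with hγ
  have hmeas_to : Measurable (toLp 2 : (Edge d L × B.ι → ℝ) → EuclideanSpace ℝ (Edge d L × B.ι)) :=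
    WithLp.measurable_toLp 2 _
  have hmeas_of : Measurable (ofLp : EuclideanSpace ℝ (Edge d L × B.ι) → (Edge d L × B.ι → ℝ)) :=
    WithLp.measurable_ofLp 2 _
  have h1 : γ.map (toLp 2) = stdGaussian (EuclideanSpace ℝ (Edge d L × B.ι)) := map_pi_eq_stdGaussian
  have h2 : (stdGaussian (EuclideanSpace ℝ (Edge d L × B.ι))).map (coordIsometry B T hT) =
      stdGaussian (EuclideanSpace ℝ (Edge d L × B.ι)) := stdGaussian_map _
  have h3 : (stdGaussian (EuclideanSpace ℝ (Edge d L × B.ι))).map ofLp = γ := by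
    rw [← h1, Measure.map_map hmeas_of hmeas_to]
    simp only [Function.comp_def, Measure.map_id']
  have hfun : (coordMap B T : (Edge d L × B.ι → ℝ) → (Edge d L × B.ι → ℝ)) =
      ofLp ∘ (coordIsometry B T hT) ∘ toLp 2 := by
    funext c
    simp only [Function.comp_apply, coordIsometry_apply, ofLp_toLp]
  have hiso : Measurable (coordIsometry B T hT) := (coordIsometry B T hT).continuous.measurable
  rw [hfun, ← Measure.map_map hmeas_of (hiso.comp hmeas_to), ← Measure.map_map hiso hmeas_to, h1, h2, h3]

/-- The coordinate form of such a transport, as a measurable equivalence of `ℝ^{E×ι}` (a continuous linear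
bijection of a finite-dimensional space). -/
def coordMeasurableEquiv (T : (Edge d L → suAlgebra n) →ₗ[ℝ] (Edge d L → suAlgebra n))
    (hT : ∀ P, kinetic (T P) = kinetic P) : (Edge d L × B.ι → ℝ) ≃ᵐ (Edge d L × B.ι → ℝ) :=
  ((((WithLp.linearEquiv 2 ℝ (Edge d L × B.ι → ℝ)).symm.trans (coordIsometry B T hT).toLinearEquiv).trans
    (WithLp.linearEquiv 2 ℝ (Edge d L × B.ι → ℝ))).toContinuousLinearEquiv).toHomeomorph.toMeasurableEquiv

/-- `coordMeasurableEquiv` acts by `coordMap`. -/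
theorem coordMeasurableEquiv_apply (T : (Edge d L → suAlgebra n) →ₗ[ℝ] (Edge d L → suAlgebra n))
    (hT : ∀ P, kinetic (T P) = kinetic P) (c : Edge d L × B.ι → ℝ) :
    coordMeasurableEquiv B T hT c = coordMap B T c := rfl

/-- **The coordinate form of the transport preserves the Gaussian law** (`MeasurePreserving`). -/
theorem measurePreserving_coordMap (T : (Edge d L → suAlgebra n) →ₗ[ℝ] (Edge d L → suAlgebra n))
    (hT : ∀ P, kinetic (T P) = kinetic P) :
    MeasurePreserving (coordMeasurableEquiv B T hT) (Measure.pi fun _ : Edge d L × B.ι => gaussianReal 0 1)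
      (Measure.pi fun _ : Edge d L × B.ι => gaussianReal 0 1) := by
  refine ⟨(coordMeasurableEquiv B T hT).measurable, ?_⟩
  have h : ((coordMeasurableEquiv B T hT) : (Edge d L × B.ι → ℝ) → (Edge d L × B.ι → ℝ)) = coordMap B T :=
    funext fun c => coordMeasurableEquiv_apply B T hT c
  rw [h, pi_gaussian_map_coordMap B T hT]

/-- **Expectations over the momentum draw are invariant under the transport**: for EVERY function `F` of the
momentum field (no measurability needed), `E[F(T P)] = E[F(P)]` when `P = Σ c(e,a)Tᵃ` with i.i.d. standard
normal `c`. -/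
theorem integral_comp_transport (T : (Edge d L → suAlgebra n) →ₗ[ℝ] (Edge d L → suAlgebra n))
    (hT : ∀ P, kinetic (T P) = kinetic P) {G : Type*} [NormedAddCommGroup G] [NormedSpace ℝ G]
    (F : (Edge d L → suAlgebra n) → G) :
    ∫ c, F (T (momOf B c)) ∂(Measure.pi fun _ : Edge d L × B.ι => gaussianReal 0 1) =
      ∫ c, F (momOf B c) ∂(Measure.pi fun _ : Edge d L × B.ι => gaussianReal 0 1) := by
  have h := (measurePreserving_coordMap B T hT).integral_comp (coordMeasurableEquiv B T hT).measurableEmbedding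
    (fun c => F (momOf B c))
  simp only [coordMeasurableEquiv_apply, ← apply_momOf] at h
  exact h

/-- **Probabilities of events about the transported momentum field equal those about the field itself**, for
EVERY set `A` of momentum fields. -/
theorem measure_transport_momOf_mem (T : (Edge d L → suAlgebra n) →ₗ[ℝ] (Edge d L → suAlgebra n))
    (hT : ∀ P, kinetic (T P) = kinetic P) (A : Set (Edge d L → suAlgebra n)) :
    (Measure.pi fun _ : Edge d L × B.ι => gaussianReal 0 1) {c | T (momOf B c) ∈ A} =
      (Measure.pi fun _ : Edge d L × B.ι => gaussianReal 0 1) {c | momOf B c ∈ A} := by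
  have h := (measurePreserving_coordMap B T hT).map_eq
  have key : (Measure.pi fun _ : Edge d L × B.ι => gaussianReal 0 1) ((coordMeasurableEquiv B T hT) ⁻¹'
      {c | momOf B c ∈ A}) = (Measure.pi fun _ : Edge d L × B.ι => gaussianReal 0 1) {c | momOf B c ∈ A} := by
    rw [← MeasurableEquiv.map_apply, h]
  rw [← key]
  congr 1
  ext c
  simp only [Set.mem_preimage, Set.mem_setOf_eq, coordMeasurableEquiv_apply, ← apply_momOf]

end Law

/-! ## §4 The three transports of `KickDriftSymmetry` are linear and kinetic-energy preserving -/

section Transports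

variable [NeZero L]

/-- `Ad_g` on momentum fields as a linear map. -/
def gaugeRegₗ (g : Site d L → Matrix.specialUnitaryGroup (Fin n) ℂ) :
    (Edge d L → suAlgebra n) →ₗ[ℝ] (Edge d L → suAlgebra n) where
  toFun := gaugeReg g
  map_add' X Y := by funext e; simp only [gaugeReg, Pi.add_apply, suConj_add]
  map_smul' r X := by rw [RingHom.id_apply, gaugeReg_smul]

/-- Translation of momentum fields as a linear map. -/
def transRegₗ (a : Site d L) : (Edge d L → suAlgebra n) →ₗ[ℝ] (Edge d L → suAlgebra n) where
  toFun := transReg a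
  map_add' _ _ := rfl
  map_smul' _ _ := rfl

/-- The time-reflection transport relative to a link field `W`, as a linear map. -/
def reflRegₗ [NeZero d] (W : GaugeConfig d L (Matrix.specialUnitaryGroup (Fin n) ℂ)) :
    (Edge d L → suAlgebra n) →ₗ[ℝ] (Edge d L → suAlgebra n) where
  toFun := reflReg W
  map_add' X Y := by
    funext e
    obtain ⟨x, μ⟩ := e
    by_cases hμ : μ = 0
    · subst hμ
      simp only [reflReg_apply_zero, Pi.add_apply, suConj_add, neg_add]
    · simp only [reflReg_apply_of_ne _ _ _ hμ, Pi.add_apply]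
  map_smul' r X := by rw [RingHom.id_apply, reflReg_smul]

/-- **The momentum draw is invariant under `Ad_g`**: `E[F(Ad_g P)] = E[F(P)]` for every `F`, every `g`. -/
theorem integral_comp_gaugeReg (g : Site d L → Matrix.specialUnitaryGroup (Fin n) ℂ)
    {G : Type*} [NormedAddCommGroup G] [NormedSpace ℝ G] (F : (Edge d L → suAlgebra n) → G) :
    ∫ c, F (gaugeReg g (momOf B c)) ∂(Measure.pi fun _ : Edge d L × B.ι => gaussianReal 0 1) =
      ∫ c, F (momOf B c) ∂(Measure.pi fun _ : Edge d L × B.ι => gaussianReal 0 1) :=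
  integral_comp_transport B (gaugeRegₗ g) (kinetic_gaugeReg g) F

/-- **The momentum draw is invariant under translations.** -/
theorem integral_comp_transReg (a : Site d L)
    {G : Type*} [NormedAddCommGroup G] [NormedSpace ℝ G] (F : (Edge d L → suAlgebra n) → G) :
    ∫ c, F (transReg a (momOf B c)) ∂(Measure.pi fun _ : Edge d L × B.ι => gaussianReal 0 1) =
      ∫ c, F (momOf B c) ∂(Measure.pi fun _ : Edge d L × B.ι => gaussianReal 0 1) :=
  integral_comp_transport B (transRegₗ a) (kinetic_transReg a) F

/-- **The momentum draw is invariant under the time-reflection transport relative to ANY link field `W`**: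
`E[F(reflReg W P)] = E[F(P)]` for every `F` — the stochastic counterpart of `mdWord_reflPhase` /
`energyChange_reflPhase`: the HMC proposal from `Θ'U` with a fresh momentum has the law of the reflected
proposal from `U`. -/
theorem integral_comp_reflReg [NeZero d] (W : GaugeConfig d L (Matrix.specialUnitaryGroup (Fin n) ℂ))
    {G : Type*} [NormedAddCommGroup G] [NormedSpace ℝ G] (F : (Edge d L → suAlgebra n) → G) :
    ∫ c, F (reflReg W (momOf B c)) ∂(Measure.pi fun _ : Edge d L × B.ι => gaussianReal 0 1) =
      ∫ c, F (momOf B c) ∂(Measure.pi fun _ : Edge d L × B.ι => gaussianReal 0 1) :=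
  integral_comp_transport B (reflRegₗ W) (kinetic_reflReg W) F

/-- The same three invariances for probabilities of arbitrary events. -/
theorem measure_reflReg_momOf_mem [NeZero d] (W : GaugeConfig d L (Matrix.specialUnitaryGroup (Fin n) ℂ))
    (A : Set (Edge d L → suAlgebra n)) :
    (Measure.pi fun _ : Edge d L × B.ι => gaussianReal 0 1) {c | reflReg W (momOf B c) ∈ A} =
      (Measure.pi fun _ : Edge d L × B.ι => gaussianReal 0 1) {c | momOf B c ∈ A} :=
  measure_transport_momOf_mem B (reflRegₗ W) (kinetic_reflReg W) A

end Transports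

end Summit.Ventures.LatticeQCDFlow.Scoring

end
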